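import Summits.Ventures.PercRepro.RankLevelSetRuleQSliceStep

/-!
# PercRepro — THE CALCULUS OF THE PARTIAL ROW SUMS `ρ(n, r) = (Σ_{i ≤ r} C(n, i))/C(n, r)` (night-1, gen 20; dossier §31.8)

The borderline of the slice map reads `Φ(q+k, q) ≤ R̂(q, k, q−k+2) ⇐ T ≤ 1 + ρ(2q+k, q) − ρ(2q−k+2, q−k+2)`
(`phiK_le_rhat_border_of_rho`, RankLevelSetRuleQSliceBinom). This module records the elementary calculus of `ρ`, uniformly:
* **`rho_succ`** — `ρ(n, r+1) = 1 + ((r+1)/(n−r))·ρ(n, r)` for `r < n` (`C(n, r)·(r+1) = C(n, r+1)·(n−r)`);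
* **`rho_pascal`** — `ρ(n+1, r+1)·(C(n, r+1) + C(n, r)) = ρ(n, r+1)·C(n, r+1) + ρ(n, r)·C(n, r)`: `ρ(n+1, r+1)` is a MEDIANT of
  `ρ(n, r)` and `ρ(n, r+1)` (Pascal on the numerator and on the denominator);
* **`rho_le_geom`** — `ρ(n, r) ≤ (n−r+1)/(n−2r+1)` for `2r ≤ n` (every ratio `C(n, i−1)/C(n, i) ≤ r/(n−r+1)` for `i ≤ r`);
* **`rho_mono_r`** — `ρ(n, r) ≤ ρ(n, r+1)` for `2r + 1 < n` (from `rho_succ` and `rho_le_geom`);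
* **`rho_anti_n`** — `ρ(n+1, r+1) ≤ ρ(n, r+1)` for `2r + 3 ≤ n` (a mediant of two values, the smaller one first).
The conjecture of record says: along the path `(2q−k+2, q−k+2) → (2q+k, q)` — `n` up by `2k−2` (`ρ` falls), `r` up by `k−2`
(`ρ` rises) — the net rise of `ρ` is below `1 − T`. Twin: mining/night-1/g20/border_rho.py (3,480 checks). Also THE BORDERLINE PATH (§31.9): `rho_ge_one`, **`rho_stepA`** (`ρ(n+2, r+1) = (n−r+1)·(4(r+1)·ρ(n, r) + (n−2r−1))/((n+1)(n+2))`),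
`rho_stepA_diag`, `borderPath_affine_recurrence`, **`rho_path_eq`** (the `j`-fold composition along `n − 2r = k'`). Axioms: standard.
-/

namespace PercRepro

open Finset

/-- `C(n, r+1)·(r+1) = C(n, r)·(n−r)` in `ℚ` (for `r ≤ n`; `Nat.choose_succ_right_eq`). -/
lemma choose_succ_ratio_rat (n r : ℕ) (hr : r ≤ n) :
    (n.choose (r + 1) : ℚ) * ((r : ℚ) + 1) = (n.choose r : ℚ) * ((n : ℚ) - r) := by
  have h := Nat.choose_succ_right_eq n r
  have h' := congrArg (fun x : ℕ => (x : ℚ)) h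
  push_cast [Nat.cast_sub hr] at h'
  exact h'

/-- **The recursion in `r`**: `ρ(n, r+1) = 1 + ((r+1)/(n−r))·ρ(n, r)` for `r < n`. -/
theorem rho_succ (n r : ℕ) (hr : r < n) :
    (∑ i ∈ range (r + 1 + 1), (n.choose i : ℚ)) / (n.choose (r + 1) : ℚ)
      = 1 + (((r : ℚ) + 1) / ((n : ℚ) - r)) * ((∑ i ∈ range (r + 1), (n.choose i : ℚ)) / (n.choose r : ℚ)) := by
  have hc := choose_succ_ratio_rat n r hr.le
  have h0 : (0 : ℚ) < (n.choose r : ℚ) := by exact_mod_cast Nat.choose_pos hr.le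
  have hnr : (0 : ℚ) < (n : ℚ) - r := by
    have : (r : ℚ) + 1 ≤ n := by exact_mod_cast hr
    linarith
  have hC1 : (n.choose (r + 1) : ℚ) = (n.choose r : ℚ) * ((n : ℚ) - r) / ((r : ℚ) + 1) := by
    rw [eq_div_iff (by positivity)]; exact hc
  rw [Finset.sum_range_succ _ (r + 1), hC1]
  field_simp
  ring

/-- **Pascal in `ρ`**: `ρ(n+1, r+1)·(C(n, r+1) + C(n, r)) = ρ(n, r+1)·C(n, r+1) + ρ(n, r)·C(n, r)` — `ρ(n+1, r+1)` is a
mediant of `ρ(n, r)` and `ρ(n, r+1)`. -/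
theorem rho_pascal (n r : ℕ) (hr : r + 1 ≤ n) :
    (∑ i ∈ range (r + 1 + 1), ((n + 1).choose i : ℚ)) / ((n + 1).choose (r + 1) : ℚ)
        * ((n.choose (r + 1) : ℚ) + (n.choose r : ℚ))
      = (∑ i ∈ range (r + 1 + 1), (n.choose i : ℚ)) / (n.choose (r + 1) : ℚ) * (n.choose (r + 1) : ℚ)
        + (∑ i ∈ range (r + 1), (n.choose i : ℚ)) / (n.choose r : ℚ) * (n.choose r : ℚ) := by
  have hP : ∑ i ∈ range (r + 1 + 1), ((n + 1).choose i : ℚ)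
      = ∑ i ∈ range (r + 1 + 1), (n.choose i : ℚ) + ∑ i ∈ range (r + 1), (n.choose i : ℚ) := by
    have h := sum_choose_succ_eq n (r + 1)
    have h' := congrArg (fun x : ℕ => (x : ℚ)) h
    push_cast at h'
    exact h'
  have hD : ((n + 1).choose (r + 1) : ℚ) = (n.choose (r + 1) : ℚ) + (n.choose r : ℚ) := by
    rw [Nat.choose_succ_succ']; push_cast; ring
  have h0 : (0 : ℚ) < (n.choose r : ℚ) := by exact_mod_cast Nat.choose_pos (by omega)
  have h1 : (0 : ℚ) < (n.choose (r + 1) : ℚ) := by exact_mod_cast Nat.choose_pos hr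
  rw [hP, hD]
  field_simp

/-- Each ratio `C(n, i−1)/C(n, i) ≤ r/(n−r+1)` for `1 ≤ i ≤ r ≤ n/2`, so **`ρ(n, r) ≤ (n−r+1)/(n−2r+1)`** (a geometric series;
by induction on `r` through `rho_succ`). -/
theorem rho_le_geom (n r : ℕ) (hr : 2 * r ≤ n) :
    (∑ i ∈ range (r + 1), (n.choose i : ℚ)) / (n.choose r : ℚ) ≤ ((n : ℚ) - r + 1) / ((n : ℚ) - 2 * r + 1) := by
  induction r with
  | zero =>
    simp only [zero_add, Finset.sum_range_one, Nat.choose_zero_right, Nat.cast_one, div_one, Nat.cast_zero,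
      mul_zero, sub_zero]
    rw [le_div_iff₀ (by positivity)]; linarith
  | succ r ih =>
    have hr' : 2 * r ≤ n := by omega
    have hn : (2 * r + 2 : ℚ) ≤ n := by exact_mod_cast hr
    rw [rho_succ n r (by omega)]
    have hih := ih hr'
    have hnr : (0 : ℚ) < (n : ℚ) - r := by linarith
    have hn2 : (0 : ℚ) < (n : ℚ) - 2 * r + 1 := by linarith
    have hmul : (((r : ℚ) + 1) / ((n : ℚ) - r)) * ((∑ i ∈ range (r + 1), (n.choose i : ℚ)) / (n.choose r : ℚ))
        ≤ (((r : ℚ) + 1) / ((n : ℚ) - r)) * (((n : ℚ) - r + 1) / ((n : ℚ) - 2 * r + 1)) :=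
      mul_le_mul_of_nonneg_left hih (by positivity)
    have e : 1 + (((r : ℚ) + 1) / ((n : ℚ) - r)) * (((n : ℚ) - r + 1) / ((n : ℚ) - 2 * r + 1))
        = (((n : ℚ) - r) * ((n : ℚ) - 2 * r + 1) + ((r : ℚ) + 1) * ((n : ℚ) - r + 1))
          / (((n : ℚ) - r) * ((n : ℚ) - 2 * r + 1)) := by
      have hnr' : (n : ℚ) - r ≠ 0 := hnr.ne'
      have hn2' : (n : ℚ) - 2 * r + 1 ≠ 0 := hn2.ne'
      rw [div_mul_div_comm, eq_div_iff (mul_ne_zero hnr' hn2'), add_mul, one_mul,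
        div_mul_cancel₀ _ (mul_ne_zero hnr' hn2')]
    have hfin : (((n : ℚ) - r) * ((n : ℚ) - 2 * r + 1) + ((r : ℚ) + 1) * ((n : ℚ) - r + 1))
          / (((n : ℚ) - r) * ((n : ℚ) - 2 * r + 1))
        ≤ ((n : ℚ) - ((r + 1 : ℕ) : ℚ) + 1) / ((n : ℚ) - 2 * ((r + 1 : ℕ) : ℚ) + 1) := by
      push_cast
      rw [div_le_div_iff₀ (by positivity) (by linarith)]
      nlinarith [mul_nonneg (Nat.cast_nonneg (α := ℚ) n) (Nat.cast_nonneg (α := ℚ) r), hn]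
    calc 1 + (((r : ℚ) + 1) / ((n : ℚ) - r)) * ((∑ i ∈ range (r + 1), (n.choose i : ℚ)) / (n.choose r : ℚ))
        ≤ 1 + (((r : ℚ) + 1) / ((n : ℚ) - r)) * (((n : ℚ) - r + 1) / ((n : ℚ) - 2 * r + 1)) := by linarith [hmul]
      _ = _ := e
      _ ≤ _ := hfin

/-- **`ρ` is nondecreasing in `r`** below the middle: `ρ(n, r) ≤ ρ(n, r+1)` for `2r + 1 < n`. -/
theorem rho_mono_r (n r : ℕ) (hr : 2 * r + 1 < n) :
    (∑ i ∈ range (r + 1), (n.choose i : ℚ)) / (n.choose r : ℚ)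
      ≤ (∑ i ∈ range (r + 1 + 1), (n.choose i : ℚ)) / (n.choose (r + 1) : ℚ) := by
  rw [rho_succ n r (by omega)]
  have hg := rho_le_geom n r (by omega)
  set ρ := (∑ i ∈ range (r + 1), (n.choose i : ℚ)) / (n.choose r : ℚ) with hρ
  have hρ0 : 0 ≤ ρ := by rw [hρ]; positivity
  have hn : (2 * r + 2 : ℚ) ≤ n := by exact_mod_cast hr
  have hnr : (0 : ℚ) < (n : ℚ) - r := by linarith
  have h1 : ρ * ((n : ℚ) - 2 * r + 1) ≤ (n : ℚ) - r + 1 := by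
    rw [le_div_iff₀ (by linarith)] at hg; exact hg
  -- ρ(n − 2r − 1) ≤ n − r  ⟸  ρ(n − 2r + 1) ≤ n − r + 1 and ρ ≥ 0 … : ρ(n−2r−1) = ρ(n−2r+1) − 2ρ ≤ n − r + 1 − 2ρ ≤ n − r + 1;
  -- sharper: from the geometric bound, ρ ≤ (n−r+1)/(n−2r+1) ≤ (n−r)/(n−2r−1) (shown in rho_le_geom's step)
  have hkey : ρ * ((n : ℚ) - 2 * r - 1) ≤ (n : ℚ) - r := by
    have h2 : ρ * ((n : ℚ) - 2 * r + 1) * ((n : ℚ) - 2 * r - 1) ≤ ((n : ℚ) - r + 1) * ((n : ℚ) - 2 * r - 1) :=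
      mul_le_mul_of_nonneg_right h1 (by linarith)
    have h3 : ((n : ℚ) - r + 1) * ((n : ℚ) - 2 * r - 1) ≤ ((n : ℚ) - r) * ((n : ℚ) - 2 * r + 1) := by nlinarith
    have h4 : ρ * ((n : ℚ) - 2 * r - 1) * ((n : ℚ) - 2 * r + 1) ≤ ((n : ℚ) - r) * ((n : ℚ) - 2 * r + 1) := by
      nlinarith [h2, h3]
    exact le_of_mul_le_mul_right h4 (by linarith)
  have e : (1 : ℚ) + (((r : ℚ) + 1) / ((n : ℚ) - r)) * ρ = (((n : ℚ) - r) + ((r : ℚ) + 1) * ρ) / ((n : ℚ) - r) := by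
    have hnr' : (n : ℚ) - r ≠ 0 := hnr.ne'
    rw [eq_div_iff hnr']
    field_simp
  rw [e, le_div_iff₀ hnr]
  linarith [hkey]

/-- **`ρ` is nonincreasing in `n`** below the middle: `ρ(n+1, r+1) ≤ ρ(n, r+1)` for `2r + 3 ≤ n` (a mediant of `ρ(n, r) ≤ ρ(n, r+1)`). -/
theorem rho_anti_n (n r : ℕ) (hr : 2 * r + 3 ≤ n) :
    (∑ i ∈ range (r + 1 + 1), ((n + 1).choose i : ℚ)) / ((n + 1).choose (r + 1) : ℚ)
      ≤ (∑ i ∈ range (r + 1 + 1), (n.choose i : ℚ)) / (n.choose (r + 1) : ℚ) := by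
  have hp := rho_pascal n r (by omega)
  have hm := rho_mono_r n r (by omega)
  have h0 : (0 : ℚ) < (n.choose r : ℚ) := by exact_mod_cast Nat.choose_pos (by omega)
  have h1 : (0 : ℚ) < (n.choose (r + 1) : ℚ) := by exact_mod_cast Nat.choose_pos (by omega)
  set A := (∑ i ∈ range (r + 1 + 1), ((n + 1).choose i : ℚ)) / ((n + 1).choose (r + 1) : ℚ) with hA
  set B := (∑ i ∈ range (r + 1 + 1), (n.choose i : ℚ)) / (n.choose (r + 1) : ℚ) with hB
  set C := (∑ i ∈ range (r + 1), (n.choose i : ℚ)) / (n.choose r : ℚ) with hC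
  -- A·(c₁ + c₀) = B·c₁ + C·c₀ ≤ B·c₁ + B·c₀
  have : A * ((n.choose (r + 1) : ℚ) + (n.choose r : ℚ)) ≤ B * ((n.choose (r + 1) : ℚ) + (n.choose r : ℚ)) := by
    rw [hp]
    have := mul_le_mul_of_nonneg_right hm h0.le
    linarith
  exact le_of_mul_le_mul_right this (by positivity)

/-! ### The borderline path: the A-step is affine in `ρ`, and the `j`-fold composition (dossier §31.9) -/


/-- `ρ(n, r) ≥ 1` for `r ≤ n` (the top term of the partial sum). -/
lemma rho_ge_one (n r : ℕ) (hr : r ≤ n) : (1 : ℚ) ≤ (∑ i ∈ range (r + 1), (n.choose i : ℚ)) / (n.choose r : ℚ) := by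
  have hC : (0 : ℚ) < (n.choose r : ℚ) := by exact_mod_cast Nat.choose_pos hr
  rw [le_div_iff₀ hC, one_mul, Finset.sum_range_succ]
  exact le_add_of_nonneg_left (Finset.sum_nonneg (fun i _ => by positivity))

/-- **The A-step of the borderline path is affine in `ρ`**: for `r + 1 ≤ n`,
`ρ(n+2, r+1) = (n−r+1)·(4(r+1)·ρ(n, r) + (n−2r−1))/((n+1)(n+2))`. -/
theorem rho_stepA (n r : ℕ) (hr : r + 1 ≤ n) :
    (∑ i ∈ range (r + 1 + 1), ((n + 2).choose i : ℚ)) / ((n + 2).choose (r + 1) : ℚ)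
      = ((n : ℚ) - r + 1) * (4 * ((r : ℚ) + 1) * ((∑ i ∈ range (r + 1), (n.choose i : ℚ)) / (n.choose r : ℚ))
          + ((n : ℚ) - 2 * r - 1)) / (((n : ℚ) + 1) * ((n : ℚ) + 2)) := by
  set ρ := (∑ i ∈ range (r + 1), (n.choose i : ℚ)) / (n.choose r : ℚ) with hρ
  set ρ1 := (∑ i ∈ range (r + 1 + 1), (n.choose i : ℚ)) / (n.choose (r + 1) : ℚ) with hρ1
  set σ := (∑ i ∈ range (r + 1), ((n + 1).choose i : ℚ)) / ((n + 1).choose r : ℚ) with hσ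
  set σ1 := (∑ i ∈ range (r + 1 + 1), ((n + 1).choose i : ℚ)) / ((n + 1).choose (r + 1) : ℚ) with hσ1
  set τ1 := (∑ i ∈ range (r + 1 + 1), ((n + 2).choose i : ℚ)) / ((n + 2).choose (r + 1) : ℚ) with hτ1
  have hC0 : (0 : ℚ) < (n.choose r : ℚ) := by exact_mod_cast Nat.choose_pos (by omega)
  have hC1 : (0 : ℚ) < (n.choose (r + 1) : ℚ) := by exact_mod_cast Nat.choose_pos hr
  have hD0 : (0 : ℚ) < ((n + 1).choose r : ℚ) := by exact_mod_cast Nat.choose_pos (by omega)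
  have hD1 : (0 : ℚ) < ((n + 1).choose (r + 1) : ℚ) := by exact_mod_cast Nat.choose_pos (by omega)
  have hnr : (0 : ℚ) < (n : ℚ) - r := by
    have : (r : ℚ) + 1 ≤ n := by exact_mod_cast hr
    linarith
  -- the ratios
  have r1 : (n.choose (r + 1) : ℚ) = (n.choose r : ℚ) * ((n : ℚ) - r) / ((r : ℚ) + 1) := by
    rw [eq_div_iff (by positivity)]; exact choose_succ_ratio_rat n r (by omega)
  have r2 : ((n + 1).choose (r + 1) : ℚ) = ((n + 1).choose r : ℚ) * ((n : ℚ) + 1 - r) / ((r : ℚ) + 1) := by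
    rw [eq_div_iff (by positivity)]
    have := choose_succ_ratio_rat (n + 1) r (by omega)
    push_cast at this; linarith [this]
  have p1 : ((n + 1).choose (r + 1) : ℚ) = (n.choose (r + 1) : ℚ) + (n.choose r : ℚ) := by
    rw [Nat.choose_succ_succ']; push_cast; ring
  have p2 : ((n + 2).choose (r + 1) : ℚ) = ((n + 1).choose (r + 1) : ℚ) + ((n + 1).choose r : ℚ) := by
    rw [show n + 2 = n + 1 + 1 by ring, Nat.choose_succ_succ']; push_cast; ring
  -- ρ1 = 1 + ((r+1)/(n−r)) ρ ; σ1 = 1 + ((r+1)/(n+1−r)) σ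
  have e1 : ρ1 = 1 + (((r : ℚ) + 1) / ((n : ℚ) - r)) * ρ := rho_succ n r (by omega)
  have e2 : σ1 = 1 + (((r : ℚ) + 1) / ((n : ℚ) + 1 - r)) * σ := by
    have := rho_succ (n + 1) r (by omega); push_cast at this; exact this
  -- Pascal: σ1·(C(n,r+1) + C(n,r)) = ρ1·C(n,r+1) + ρ·C(n,r)
  have e3 : σ1 * ((n.choose (r + 1) : ℚ) + (n.choose r : ℚ)) = ρ1 * (n.choose (r + 1) : ℚ) + ρ * (n.choose r : ℚ) :=
    rho_pascal n r hr
  -- Pascal at n+1: τ1·(C(n+1,r+1) + C(n+1,r)) = σ1·C(n+1,r+1) + σ·C(n+1,r)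
  have e4 : τ1 * (((n + 1).choose (r + 1) : ℚ) + ((n + 1).choose r : ℚ))
      = σ1 * ((n + 1).choose (r + 1) : ℚ) + σ * ((n + 1).choose r : ℚ) := by
    have := rho_pascal (n + 1) r (by omega)
    rw [show n + 1 + 1 = n + 2 by ring] at this
    exact this
  -- solve: σ from e2, then τ1
  have hnr1 : (0 : ℚ) < (n : ℚ) + 1 - r := by linarith
  have hσeq : σ = (σ1 - 1) * ((n : ℚ) + 1 - r) / ((r : ℚ) + 1) := by
    rw [eq_div_iff (by positivity), e2]
    field_simp
    ring
  have hσ1eq : σ1 = (ρ1 * (n.choose (r + 1) : ℚ) + ρ * (n.choose r : ℚ)) / ((n.choose (r + 1) : ℚ) + (n.choose r : ℚ)) := by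
    rw [eq_div_iff (by positivity)]; exact e3
  have hτeq : τ1 = (σ1 * ((n + 1).choose (r + 1) : ℚ) + σ * ((n + 1).choose r : ℚ))
      / (((n + 1).choose (r + 1) : ℚ) + ((n + 1).choose r : ℚ)) := by
    rw [eq_div_iff (by positivity)]; exact e4
  rw [hτeq, hσeq, hσ1eq, e1, r2, r1]
  field_simp
  ring


/-- The A-step on the diagonal `n − 2r = k'`: `ρ(2(r+1)+k', r+1) = s(r)·ρ(2r+k', r) + c(r)` with
`s(r) = 4(r+1)(r+k'+1)/((2r+k'+1)(2r+k'+2))`, `c(r) = (r+k'+1)(k'−1)/((2r+k'+1)(2r+k'+2))` (for `1 ≤ r + k'`). -/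
lemma rho_stepA_diag (k' r : ℕ) (h : 1 ≤ r + k') :
    (∑ i ∈ range (r + 1 + 1), ((2 * (r + 1) + k').choose i : ℚ)) / ((2 * (r + 1) + k').choose (r + 1) : ℚ)
      = (4 * ((r : ℚ) + 1) * ((r : ℚ) + k' + 1) / ((2 * (r : ℚ) + k' + 1) * (2 * (r : ℚ) + k' + 2)))
          * ((∑ i ∈ range (r + 1), ((2 * r + k').choose i : ℚ)) / ((2 * r + k').choose r : ℚ))
        + ((r : ℚ) + k' + 1) * ((k' : ℚ) - 1) / ((2 * (r : ℚ) + k' + 1) * (2 * (r : ℚ) + k' + 2)) := by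
  have h1 := rho_stepA (2 * r + k') r (by omega)
  rw [show 2 * (r + 1) + k' = 2 * r + k' + 2 by ring, h1]
  push_cast
  have hpos : (0 : ℚ) < (2 * (r : ℚ) + k' + 1) * (2 * (r : ℚ) + k' + 2) := by positivity
  field_simp
  ring

/-- **A first-order affine recurrence, solved**: if `x(j+1) = s(j)·x(j) + c(j)` for all `j` then
`x(j) = (Π_{i<j} s(i))·x(0) + Σ_{i<j} c(i)·Π_{l ∈ Ico (i+1) j} s(l)`. -/
lemma borderPath_affine_recurrence (s c x : ℕ → ℚ) (h : ∀ j, x (j + 1) = s j * x j + c j) : ∀ j,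
    x j = (∏ i ∈ range j, s i) * x 0 + ∑ i ∈ range j, c i * ∏ l ∈ Finset.Ico (i + 1) j, s l := by
  intro j
  induction j with
  | zero => simp
  | succ j ih =>
    rw [h j, ih, Finset.prod_range_succ, Finset.sum_range_succ, Finset.Ico_self, Finset.prod_empty, mul_one]
    have hsum : ∑ i ∈ range j, c i * ∏ l ∈ Finset.Ico (i + 1) (j + 1), s l
        = (∑ i ∈ range j, c i * ∏ l ∈ Finset.Ico (i + 1) j, s l) * s j := by
      rw [Finset.sum_mul]
      refine Finset.sum_congr rfl (fun i hi => ?_)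
      rw [Finset.mem_range] at hi
      rw [Finset.prod_Ico_succ_top (by omega)]
      ring
    rw [hsum]
    ring

/-- **The path formula**: after `j` A-steps along the diagonal `n − 2r = k'` from `(2r₀+k', r₀)`, `1 ≤ r₀ + k'`:
`ρ(2(r₀+j)+k', r₀+j) = (Π_{i<j} s(r₀+i))·ρ(2r₀+k', r₀) + Σ_{i<j} c(r₀+i)·Π_{l ∈ Ico (i+1) j} s(r₀+l)`. -/
theorem rho_path_eq (k' r₀ : ℕ) (h : 1 ≤ r₀ + k') (j : ℕ) :
    (∑ i ∈ range (r₀ + j + 1), ((2 * (r₀ + j) + k').choose i : ℚ)) / ((2 * (r₀ + j) + k').choose (r₀ + j) : ℚ)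
      = (∏ i ∈ range j, (4 * (((r₀ + i : ℕ) : ℚ) + 1) * (((r₀ + i : ℕ) : ℚ) + k' + 1)
            / ((2 * ((r₀ + i : ℕ) : ℚ) + k' + 1) * (2 * ((r₀ + i : ℕ) : ℚ) + k' + 2))))
          * ((∑ i ∈ range (r₀ + 1), ((2 * r₀ + k').choose i : ℚ)) / ((2 * r₀ + k').choose r₀ : ℚ))
        + ∑ i ∈ range j, ((((r₀ + i : ℕ) : ℚ) + k' + 1) * ((k' : ℚ) - 1)
            / ((2 * ((r₀ + i : ℕ) : ℚ) + k' + 1) * (2 * ((r₀ + i : ℕ) : ℚ) + k' + 2)))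
          * ∏ l ∈ Finset.Ico (i + 1) j, (4 * (((r₀ + l : ℕ) : ℚ) + 1) * (((r₀ + l : ℕ) : ℚ) + k' + 1)
            / ((2 * ((r₀ + l : ℕ) : ℚ) + k' + 1) * (2 * ((r₀ + l : ℕ) : ℚ) + k' + 2))) := by
  have key := borderPath_affine_recurrence
    (fun i => 4 * (((r₀ + i : ℕ) : ℚ) + 1) * (((r₀ + i : ℕ) : ℚ) + k' + 1)
      / ((2 * ((r₀ + i : ℕ) : ℚ) + k' + 1) * (2 * ((r₀ + i : ℕ) : ℚ) + k' + 2)))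
    (fun i => (((r₀ + i : ℕ) : ℚ) + k' + 1) * ((k' : ℚ) - 1)
      / ((2 * ((r₀ + i : ℕ) : ℚ) + k' + 1) * (2 * ((r₀ + i : ℕ) : ℚ) + k' + 2)))
    (fun j => (∑ i ∈ range (r₀ + j + 1), ((2 * (r₀ + j) + k').choose i : ℚ)) / ((2 * (r₀ + j) + k').choose (r₀ + j) : ℚ))
    (fun j => by
      have := rho_stepA_diag k' (r₀ + j) (by omega)
      show (∑ i ∈ range (r₀ + (j + 1) + 1), ((2 * (r₀ + (j + 1)) + k').choose i : ℚ))
          / ((2 * (r₀ + (j + 1)) + k').choose (r₀ + (j + 1)) : ℚ) = _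
      rw [show r₀ + (j + 1) = r₀ + j + 1 by ring]
      exact this) j
  simpa only [Nat.add_zero] using key


/-! ### The product of the slopes in closed form, and `Path(1)` without the composition (dossier §31.10 cont. 15) -/

/-- `C(n+2, r+1)·(r+1)(n+1−r) = C(n, r)·(n+1)(n+2)` in `ℚ` (`r ≤ n`). -/
lemma borderPath_choose_two_step (n r : ℕ) (hr : r ≤ n) :
    ((n + 2).choose (r + 1) : ℚ) * ((r : ℚ) + 1) * ((n : ℚ) + 1 - r) = (n.choose r : ℚ) * ((n : ℚ) + 1) * ((n : ℚ) + 2) := by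
  have h1 := Nat.add_one_mul_choose_eq n r          -- (n+1) * C(n, r) = C(n+1, r+1) * (r+1)
  have h2 := Nat.choose_mul_succ_eq n r             -- C(n, r) * (n+1) = C(n+1, r) * (n+1-r)
  have hp : ((n + 2).choose (r + 1) : ℚ) = ((n + 1).choose (r + 1) : ℚ) + ((n + 1).choose r : ℚ) := by
    rw [show n + 2 = n + 1 + 1 by ring, Nat.choose_succ_succ']; push_cast; ring
  have h1' : ((n : ℚ) + 1) * (n.choose r : ℚ) = ((n + 1).choose (r + 1) : ℚ) * ((r : ℚ) + 1) := by exact_mod_cast h1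
  have h2' : (n.choose r : ℚ) * ((n : ℚ) + 1) = ((n + 1).choose r : ℚ) * ((n : ℚ) + 1 - r) := by
    have hc := congrArg (fun x : ℕ => (x : ℚ)) h2
    simp only [Nat.cast_mul, Nat.cast_add, Nat.cast_one, Nat.cast_sub (by omega : r ≤ n + 1)] at hc
    linarith [hc]
  rw [hp]
  linear_combination (-((n : ℚ) + 1 - r)) * h1' + (-((r : ℚ) + 1)) * h2'

/-- **The product of the slopes in closed form**: `Π_{i<j} s(r₀+i) = 4^j·C(2r₀+k', r₀)/C(2(r₀+j)+k', r₀+j)` with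
`s(r) = 4(r+1)(r+k'+1)/((2r+k'+1)(2r+k'+2))` (the homogeneous solution `g(r) = 4^r/C(2r+k', r)` of the A-step). -/
theorem borderPath_prod_eq (k' r₀ : ℕ) (j : ℕ) :
    ∏ i ∈ range j, (4 * (((r₀ + i : ℕ) : ℚ) + 1) * (((r₀ + i : ℕ) : ℚ) + k' + 1)
        / ((2 * ((r₀ + i : ℕ) : ℚ) + k' + 1) * (2 * ((r₀ + i : ℕ) : ℚ) + k' + 2)))
      = (4 : ℚ) ^ j * ((2 * r₀ + k').choose r₀ : ℚ) / ((2 * (r₀ + j) + k').choose (r₀ + j) : ℚ) := by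
  induction j with
  | zero => simp only [Finset.prod_range_zero, pow_zero, one_mul, Nat.add_zero]; rw [div_self (by exact_mod_cast (Nat.choose_pos (by omega)).ne')]
  | succ j ih =>
    rw [Finset.prod_range_succ, ih]
    set r := r₀ + j with hr
    have hC : (0 : ℚ) < ((2 * r + k').choose r : ℚ) := by exact_mod_cast Nat.choose_pos (by omega)
    have hC' : (0 : ℚ) < ((2 * (r + 1) + k').choose (r + 1) : ℚ) := by exact_mod_cast Nat.choose_pos (by omega)
    have key := borderPath_choose_two_step (2 * r + k') r (by omega)
    rw [show 2 * r + k' + 2 = 2 * (r + 1) + k' by ring] at key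
    push_cast at key
    rw [show r₀ + (j + 1) = r + 1 by omega]
    have hpos1 : (0 : ℚ) < (2 * (r : ℚ) + k' + 1) * (2 * (r : ℚ) + k' + 2) := by positivity
    rw [div_mul_div_comm, div_eq_div_iff (by positivity) (by positivity)]
    have e : ((2 * (r : ℚ) + k') + 1 - r) = (r : ℚ) + k' + 1 := by ring
    rw [e] at key
    rw [pow_succ]
    linear_combination ((4 : ℚ) ^ j * ((2 * r₀ + k').choose r₀ : ℚ) * 4) * key

/-- **`Path_A(1)` in closed form**: with `A = Π_{i≤k'} s(m+i)` and `B` the intercept sum of `rho_path_eq` (`j = k'+1`, `r₀ = m`),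
`A·1 + B − 1 = ρ(2q+k, q+1) − 1 − A·(ρ′ − 1)` where `q = m + k'`, `ρ′ = ρ(2m+k', m)`, and
`A = 4^{k'+1}·C(2m+k', m)/C(2q+k, q+1)` — so inequality (I) of the borderline needs no `k`-fold composition. -/
theorem borderPath_one_closed (k' m : ℕ) (h : 1 ≤ m + k') :
    (∏ i ∈ range (k' + 1), (4 * (((m + i : ℕ) : ℚ) + 1) * (((m + i : ℕ) : ℚ) + k' + 1)
        / ((2 * ((m + i : ℕ) : ℚ) + k' + 1) * (2 * ((m + i : ℕ) : ℚ) + k' + 2)))) * 1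
      + ∑ i ∈ range (k' + 1), ((((m + i : ℕ) : ℚ) + k' + 1) * ((k' : ℚ) - 1)
        / ((2 * ((m + i : ℕ) : ℚ) + k' + 1) * (2 * ((m + i : ℕ) : ℚ) + k' + 2)))
        * ∏ l ∈ Finset.Ico (i + 1) (k' + 1), (4 * (((m + l : ℕ) : ℚ) + 1) * (((m + l : ℕ) : ℚ) + k' + 1)
        / ((2 * ((m + l : ℕ) : ℚ) + k' + 1) * (2 * ((m + l : ℕ) : ℚ) + k' + 2))) - 1
      = (∑ i ∈ range (m + (k' + 1) + 1), ((2 * (m + (k' + 1)) + k').choose i : ℚ))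
          / ((2 * (m + (k' + 1)) + k').choose (m + (k' + 1)) : ℚ) - 1
        - ((4 : ℚ) ^ (k' + 1) * ((2 * m + k').choose m : ℚ) / ((2 * (m + (k' + 1)) + k').choose (m + (k' + 1)) : ℚ))
          * ((∑ i ∈ range (m + 1), ((2 * m + k').choose i : ℚ)) / ((2 * m + k').choose m : ℚ) - 1) := by
  have hp := rho_path_eq k' m h (k' + 1)
  have hA := borderPath_prod_eq k' m (k' + 1)
  rw [hA] at hp ⊢
  linear_combination (-1 : ℚ) * hp


end PercRepro
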